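import Summits.CriticalPhenomena.Ising3D.IsingColumnFaceL11CensusSegmentLin

/-!
# The `LIN` census of §7.3 on the certified `Δε` segment as kernel facts, II: candidates, parts, the
kernel check and its soundness (cell `pub-ising3x`, seat recog-1; paper §7.1 / §7.3)

HONEST FRAMING: lottery ticket; floor = tightest certified 3D Ising CFT bounds; no exact-solution
claim without a proof. Island framing: certified exclusion region at stated derivative order and
assumptions; not a determination of the 3D Ising critical exponents beyond that.

Part II of the enumerate-and-decide machine of `IsingColumnFaceL11CensusSegmentLin.lean`:
* `linCandsOf c` — for one coefficient vector, every tuple `(a₀, c, aₓ)`, `aₓ ∈ [1, 12]`, with `a₀` in the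
  outward-rounded integer range of the segment (the range of the landed checker `linExcluded`), tagged
  `(bin, primitive?)` (`mem_linCandsOf_iff`); the RANGE ARGUMENT `lin_a0_mem_range` (as in
  `linExcluded_sound`: a tuple whose value lies in the segment has `a₀` in the range);
* `linSegPart i` (the candidates of the vectors with first non-zero index `i`), `linSegAll` (all seven
  parts; `mem_linSegAll_iff`, `linSegAll_shape`), COMPLETENESS `mem_linSegAll_of_mem_segment` (every
  tuple of the table `linFamily 12` whose value lies in `[81/64, 2855/2048]` is a candidate);
* the kernel check `linSegCheck i n₀ n₁ n₂` (all bins of part `i` decided, the tuple codes `linCode`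
  strictly increasing along the list — so no duplicates, `nodup_of_incrNat_map` —, and `n₀ / n₁ / n₂`
  primitive candidates in the three sub-window bins) with `linSegCheck_spec`; `countP_linSegAll`
  (a count over the whole list is the sum over the parts) and `nodup_linSegAll_snd` (parts are disjoint
  by the first non-zero index).
The seven kernel evaluations and the theorems: `…SegmentLinA/B/C.lean`.
No certificate, no datum, no axiom of the σ–ε system; nothing is recognised.
lottery ticket; floor = tightest certified 3D Ising CFT bounds; no exact-solution claim without a proof.
-/

namespace Summit.CriticalPhenomena.Ising3D
namespace ColumnFaceL11
open Set Literature.MathematicalPhysics.QuantumFieldTheory.ConformalBootstrap3D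

/-! ### List and interval helpers -/

/-- Strictly increasing list of naturals (one pass). [folklore] -/
def incrNat : List ℕ → Bool
  | [] => true
  | [_] => true
  | a :: b :: l => Nat.blt a b && incrNat (b :: l)

/-- `incrNat l` ⇒ `l` is pairwise `<`. [folklore] -/
theorem pairwise_lt_of_incrNat : ∀ {l : List ℕ}, incrNat l = true → l.Pairwise (· < ·)
  | [], _ => List.Pairwise.nil
  | [a], _ => List.pairwise_singleton _ a
  | a :: b :: l, h => by
      simp only [incrNat, Bool.and_eq_true, Nat.blt_eq] at h
      have ih := pairwise_lt_of_incrNat h.2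
      refine List.Pairwise.cons ?_ ih
      intro x hx
      rcases List.mem_cons.mp hx with rfl | hx
      · exact h.1
      · exact lt_trans h.1 (List.rel_of_pairwise_cons ih hx)

/-- `incrNat (l.map f)` ⇒ `l` has no duplicates (no injectivity of `f` needed). [folklore] -/
theorem nodup_of_incrNat_map {α : Type*} (f : α → ℕ) {l : List α} (h : incrNat (l.map f) = true) :
    l.Nodup :=
  List.Nodup.of_map f ((pairwise_lt_of_incrNat h).imp ne_of_lt)

/-- List twin of `coeffLoop`: all completions of `acc` by `k` further entries in `[−H, H]`, in increasing
lexicographic order. [folklore] -/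
def coeffLoopL (H : ℤ) : ℕ → List ℤ → List (List ℤ)
  | 0, acc => [acc]
  | k + 1, acc => (iccList (-H) H).flatMap fun a => coeffLoopL H k (acc ++ [a])

/-- What `coeffLoopL` lists. [folklore] -/
theorem mem_coeffLoopL_iff {H : ℤ} : ∀ (k : ℕ) (acc c : List ℤ),
    c ∈ coeffLoopL H k acc ↔ ∃ pre : List ℤ, pre.length = k ∧ (∀ y ∈ pre, -H ≤ y ∧ y ≤ H) ∧ c = acc ++ pre
  | 0, acc, c => by
      simp only [coeffLoopL, List.mem_singleton]
      constructor
      · rintro rfl; exact ⟨[], rfl, by simp, by simp⟩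
      · rintro ⟨pre, hlen, -, rfl⟩; rw [List.eq_nil_of_length_eq_zero hlen, List.append_nil]
  | k + 1, acc, c => by
      rw [coeffLoopL, List.mem_flatMap]
      constructor
      · rintro ⟨a, ha, hc⟩
        rw [mem_iccList] at ha
        obtain ⟨pre, hlen, hb, rfl⟩ := (mem_coeffLoopL_iff k _ c).mp hc
        refine ⟨a :: pre, by simp [hlen], ?_, by simp⟩
        intro y hy
        rcases List.mem_cons.mp hy with rfl | hy
        · exact ha
        · exact hb y hy
      · rintro ⟨pre, hlen, hb, rfl⟩
        cases pre with
        | nil => simp at hlen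
        | cons a pre' =>
          refine ⟨a, mem_iccList.mpr (hb a (by simp)), (mem_coeffLoopL_iff k _ _).mpr ?_⟩
          exact ⟨pre', by simpa using hlen, fun y hy => hb y (List.mem_cons_of_mem _ hy), by simp⟩

/-- Outward rounding of a rational enclosure to denominator `10¹⁵` (a kernel-cost device for
enclosures that are products of many-digit rationals: compare on the rounded, slightly wider interval). [folklore] -/
def roundOut (m : ℚ × ℚ) : ℚ × ℚ := ((⌊m.1 * 10 ^ 15⌋ : ℚ) / 10 ^ 15, (⌈m.2 * 10 ^ 15⌉ : ℚ) / 10 ^ 15)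

/-- Soundness of `roundOut`. [folklore] -/
theorem roundOut_sound {m : ℚ × ℚ} {y : ℝ} (h1 : (m.1 : ℝ) ≤ y) (h2 : y ≤ m.2) :
    ((roundOut m).1 : ℝ) ≤ y ∧ y ≤ ((roundOut m).2 : ℝ) := by
  have e1 : (roundOut m).1 ≤ m.1 := by
    simp only [roundOut]; rw [div_le_iff₀ (by norm_num)]; exact Int.floor_le _
  have e2 : m.2 ≤ (roundOut m).2 := by
    simp only [roundOut]; rw [le_div_iff₀ (by norm_num)]; exact Int.le_ceil _
  exact ⟨le_trans (by exact_mod_cast e1) h1, le_trans h2 (by exact_mod_cast e2)⟩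

/-- If the members of a set are exactly the entries of a duplicate-free list, the set has `L.length`
elements. [folklore] -/
theorem set_ncard_eq_length_of_iff {α : Type*} [DecidableEq α] {S : Set α} {L : List α} (hL : L.Nodup)
    (h : ∀ r, r ∈ S ↔ r ∈ L) : S.ncard = L.length := by
  have hS : S = ↑L.toFinset := Set.ext fun r => by rw [Finset.mem_coe, List.mem_toFinset]; exact h r
  rw [hS, Set.ncard_coe_finset, List.toFinset_card_of_nodup hL]

/-- Counting a disjoint union of finite fibres over a duplicate-free list. [folklore] -/
theorem ncard_pairs_of_list {α β : Type*} [DecidableEq α] (R : α → Set β) : ∀ (C : List α), C.Nodup →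
    (∀ c ∈ C, (R c).Finite) →
    {p : α × β | p.1 ∈ C ∧ p.2 ∈ R p.1}.Finite ∧
      {p : α × β | p.1 ∈ C ∧ p.2 ∈ R p.1}.ncard = (C.map fun c => (R c).ncard).sum
  | [], _, _ => by
      have he : {p : α × β | p.1 ∈ ([] : List α) ∧ p.2 ∈ R p.1} = ∅ :=
        Set.eq_empty_iff_forall_notMem.mpr fun p hp => by simp at hp
      rw [he]; exact ⟨Set.finite_empty, by simp⟩
  | c :: C, hnd, hfin => by
      rw [List.nodup_cons] at hnd
      obtain ⟨hcC, hnd'⟩ := hnd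
      obtain ⟨hf', hc'⟩ := ncard_pairs_of_list R C hnd' fun x hx => hfin x (List.mem_cons_of_mem _ hx)
      have hfc := hfin c (by simp)
      have hU : {p : α × β | p.1 ∈ c :: C ∧ p.2 ∈ R p.1} =
          (Prod.mk c '' R c) ∪ {p : α × β | p.1 ∈ C ∧ p.2 ∈ R p.1} := by
        ext p
        obtain ⟨p1, p2⟩ := p
        simp only [Set.mem_setOf_eq, List.mem_cons, Set.mem_union, Set.mem_image, Prod.mk.injEq]
        constructor
        · rintro ⟨rfl | h1, h2⟩
          · exact Or.inl ⟨p2, h2, rfl, rfl⟩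
          · exact Or.inr ⟨h1, h2⟩
        · rintro (⟨y, hy, rfl, rfl⟩ | ⟨h1, h2⟩)
          · exact ⟨Or.inl rfl, hy⟩
          · exact ⟨Or.inr h1, h2⟩
      have hdisj : Disjoint (Prod.mk c '' R c) {p : α × β | p.1 ∈ C ∧ p.2 ∈ R p.1} := by
        rw [Set.disjoint_left]
        rintro p ⟨y, -, rfl⟩ ⟨h1, -⟩
        exact hcC h1
      have hinj : Function.Injective (Prod.mk c : β → α × β) := fun x y hxy => by simpa using hxy
      have hfi : (Prod.mk c '' R c).Finite := hfc.image _
      rw [hU]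
      refine ⟨hfi.union hf', ?_⟩
      rw [Set.ncard_union_eq hdisj hfi hf', Set.ncard_image_of_injective _ hinj, hc', List.map_cons,
        List.sum_cons]

/-! ### The candidates of one vector, and the range argument -/

/-- Candidates for one coefficient vector `c` from shared data `T = linZEncl 0 c`, `g = gcdList c`:
`aₓ ∈ [1, 12]`, `a₀` in the outward-rounded integer range of the segment, each tagged
`(bin, primitive?)`. [folklore] -/
def linCandsT (c : List ℤ) (T1 T2 : ℤ) (g : ℕ) : List ((ℕ × Bool) × (ℤ × List ℤ × ℕ)) :=
  (List.range' 1 12).flatMap fun ax : ℕ =>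
    (iccList (-((-(segCut 0 * (ax : ℤ) - T2)) / (linS : ℤ))) ((segCut 3 * (ax : ℤ) - T1) / (linS : ℤ))).map
      fun a0 : ℤ =>
        ((linBin ((linS : ℤ) * a0 + T1) ((linS : ℤ) * a0 + T2) (segCut 0 * (ax : ℤ)) (segCut 1 * (ax : ℤ))
            (segCut 2 * (ax : ℤ)) (segCut 3 * (ax : ℤ)),
          Nat.gcd (Nat.gcd a0.natAbs ax) g == 1), (a0, c, ax))

/-- All tagged candidate tuples of one coefficient vector `c`. [folklore] -/
def linCandsOf (c : List ℤ) : List ((ℕ × Bool) × (ℤ × List ℤ × ℕ)) :=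
  linCandsT c (linZEncl 0 c).1 (linZEncl 0 c).2 (gcdList c)

/-- Lower end of the `a₀` candidate range of `(c, aₓ)`. [folklore] -/
def linLoOf (c : List ℤ) (ax : ℕ) : ℤ := -((-(segCut 0 * (ax : ℤ) - (linZEncl 0 c).2)) / (linS : ℤ))

/-- Upper end of the `a₀` candidate range of `(c, aₓ)`. [folklore] -/
def linHiOf (c : List ℤ) (ax : ℕ) : ℤ := (segCut 3 * (ax : ℤ) - (linZEncl 0 c).1) / (linS : ℤ)

/-- What `linCandsOf c` lists. [folklore] -/
theorem mem_linCandsOf_iff {c : List ℤ} {be : (ℕ × Bool) × (ℤ × List ℤ × ℕ)} :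
    be ∈ linCandsOf c ↔ ∃ (ax : ℕ) (a0 : ℤ), (1 ≤ ax ∧ ax ≤ 12) ∧ (linLoOf c ax ≤ a0 ∧ a0 ≤ linHiOf c ax) ∧
      be = ((linBinOf (a0, c, ax), linPrim (a0, c, ax)), (a0, c, ax)) := by
  unfold linCandsOf linCandsT
  simp only [List.mem_flatMap, List.mem_map, List.mem_range'_1, mem_iccList]
  constructor
  · rintro ⟨ax, hax, a0, ha0, rfl⟩
    exact ⟨ax, a0, by omega, ha0, rfl⟩
  · rintro ⟨ax, a0, hax, ha0, rfl⟩
    exact ⟨ax, by omega, a0, ha0, rfl⟩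

/-- **The range argument** (as in `linExcluded_sound`): a tuple `(a₀, c, aₓ)`, `aₓ ≥ 1`, whose value lies in
the segment `[81/64, 2855/2048]` has `a₀` in the candidate range of `(c, aₓ)`. [folklore] -/
theorem lin_a0_mem_range {a0 : ℤ} {c : List ℤ} {ax : ℕ} (hax : 1 ≤ ax)
    (hlo : ((segCutQ 0 : ℚ) : ℝ) ≤ lin7TupleVal (a0, c, ax))
    (hhi : lin7TupleVal (a0, c, ax) ≤ ((segCutQ 3 : ℚ) : ℝ)) :
    linLoOf c ax ≤ a0 ∧ a0 ≤ linHiOf c ax := by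
  obtain ⟨hT1, hT2⟩ := linZEncl_sound 0 c
  set T := linZEncl 0 c with hT
  have hax0 : (0 : ℝ) < ax := by exact_mod_cast hax
  have hS0 : (0 : ℤ) < (linS : ℤ) := by norm_num [linS]
  have hSR : (0 : ℝ) ≤ (linS : ℝ) := by positivity
  unfold lin7TupleVal at hlo hhi
  simp only at hlo hhi
  have hlo' : ((segCutQ 0 : ℚ) : ℝ) * ax ≤ a0 + lin7Val 0 c := by
    have := mul_le_mul_of_nonneg_right hlo hax0.le; rwa [div_mul_cancel₀ _ hax0.ne'] at this
  have hhi' : (a0 : ℝ) + lin7Val 0 c ≤ ((segCutQ 3 : ℚ) : ℝ) * ax := by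
    have := mul_le_mul_of_nonneg_right hhi hax0.le; rwa [div_mul_cancel₀ _ hax0.ne'] at this
  have hA := segCut_cast 0
  have hB := segCut_cast 3
  have i1 : segCut 0 * (ax : ℤ) - T.2 ≤ a0 * linS := by
    have e2 : (linS : ℝ) * (((segCutQ 0 : ℚ) : ℝ) * ax) ≤ linS * (a0 + lin7Val 0 c) :=
      mul_le_mul_of_nonneg_left hlo' hSR
    have e3 : ((segCut 0 : ℤ) : ℝ) * ax - T.2 ≤ a0 * linS := by rw [hA]; nlinarith
    exact_mod_cast e3
  have i2 : a0 * linS ≤ segCut 3 * (ax : ℤ) - T.1 := by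
    have e2 : (linS : ℝ) * (a0 + lin7Val 0 c) ≤ linS * (((segCutQ 3 : ℚ) : ℝ) * ax) :=
      mul_le_mul_of_nonneg_left hhi' hSR
    have e3 : (a0 : ℝ) * linS ≤ ((segCut 3 : ℤ) : ℝ) * ax - T.1 := by rw [hB]; nlinarith
    exact_mod_cast e3
  constructor
  · unfold linLoOf
    have h := (Int.le_ediv_iff_mul_le hS0).mpr
      (show -a0 * (linS : ℤ) ≤ -(segCut 0 * (ax : ℤ) - T.2) by linarith)
    linarith
  · unfold linHiOf
    exact (Int.le_ediv_iff_mul_le hS0).mpr i2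

/-! ### Parts, the whole candidate list, and the kernel check -/

/-- Part `i` of the tagged candidate list: the vectors with first non-zero index `i`. [folklore] -/
def linSegPart (i : ℕ) : List ((ℕ × Bool) × (ℤ × List ℤ × ℕ)) := (linVecsFirst i).flatMap linCandsOf

/-- The whole tagged candidate list of the segment (parts `0, …, 6`). [folklore] -/
def linSegAll : List ((ℕ × Bool) × (ℤ × List ℤ × ℕ)) := (List.range 7).flatMap linSegPart

/-- An integer code of a tuple, increasing along the generation order (used only to certify that the
candidate list has no duplicates; injectivity is NOT needed). [folklore] -/
def linCode (e : ℤ × List ℤ × ℕ) : ℕ :=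
  ((firstNZ e.2.1 * 25 ^ 7 + e.2.1.foldl (fun acc y => acc * 25 + (y + 12).toNat) 0) * 13 + e.2.2) * 4096 +
    (e.1 + 2048).toNat

/-- The kernel check of part `i`: every candidate decided (bin `≤ 3`), codes strictly increasing, and
`n₀ / n₁ / n₂` PRIMITIVE candidates in the three sub-window bins. [folklore] -/
def linSegCheck (i n0 n1 n2 : ℕ) : Bool :=
  let L := linSegPart i
  (L.all fun be => decide (be.1.1 ≤ 3)) && incrNat (L.map fun be => linCode be.2) &&
    (L.countP fun be => be.1.1 == 0 && be.1.2) == n0 && (L.countP fun be => be.1.1 == 1 && be.1.2) == n1 &&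
    (L.countP fun be => be.1.1 == 2 && be.1.2) == n2

/-- What a passed part check gives. [folklore] -/
theorem linSegCheck_spec {i n0 n1 n2 : ℕ} (h : linSegCheck i n0 n1 n2 = true) :
    (∀ be ∈ linSegPart i, be.1.1 ≤ 3) ∧ ((linSegPart i).map Prod.snd).Nodup ∧
      (linSegPart i).countP (fun be => be.1.1 == 0 && be.1.2) = n0 ∧
      (linSegPart i).countP (fun be => be.1.1 == 1 && be.1.2) = n1 ∧
      (linSegPart i).countP (fun be => be.1.1 == 2 && be.1.2) = n2 := by
  simp only [linSegCheck, Bool.and_eq_true, List.all_eq_true, decide_eq_true_eq, beq_iff_eq] at h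
  obtain ⟨⟨⟨⟨hall, hincr⟩, h0⟩, h1⟩, h2⟩ := h
  refine ⟨hall, ?_, h0, h1, h2⟩
  have e : (linSegPart i).map (fun be => linCode be.2) = ((linSegPart i).map Prod.snd).map linCode := by
    rw [List.map_map]; rfl
  rw [e] at hincr
  exact nodup_of_incrNat_map linCode hincr

/-- Membership in a part. [folklore] -/
theorem mem_linSegPart_iff {i : ℕ} {be : (ℕ × Bool) × (ℤ × List ℤ × ℕ)} :
    be ∈ linSegPart i ↔ ∃ c ∈ linVecsFirst i, be ∈ linCandsOf c := by
  unfold linSegPart; rw [List.mem_flatMap]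

/-- Membership in the whole list. [folklore] -/
theorem mem_linSegAll_iff {be : (ℕ × Bool) × (ℤ × List ℤ × ℕ)} :
    be ∈ linSegAll ↔ ∃ i, i < 7 ∧ be ∈ linSegPart i := by
  unfold linSegAll; rw [List.mem_flatMap]
  simp only [List.mem_range]

/-- The shape of a candidate: tags = (`linBinOf`, `linPrim`) of the tuple, the tuple is in the table,
`aₓ ≥ 1`, and the vector sits in part `firstNZ`. [folklore] -/
theorem linSegAll_shape {be : (ℕ × Bool) × (ℤ × List ℤ × ℕ)} (h : be ∈ linSegAll) :
    be = ((linBinOf be.2, linPrim be.2), be.2) ∧ linTupleOK 12 be.2 = true ∧ 1 ≤ be.2.2.2 := by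
  obtain ⟨i, hi, hbe⟩ := mem_linSegAll_iff.mp h
  obtain ⟨c, hc, hbc⟩ := mem_linSegPart_iff.mp hbe
  obtain ⟨ax, a0, hax, -, rfl⟩ := mem_linCandsOf_iff.mp hbc
  exact ⟨rfl, linTupleOK_of_mem_linVecsFirst (by omega) hc hax.1 hax.2, hax.1⟩

/-- **Completeness.** A tuple of the table `linFamily 12` whose value lies in the segment is a candidate
(with its tags). [folklore] -/
theorem mem_linSegAll_of_mem_segment {e : ℤ × List ℤ × ℕ} (hok : linTupleOK 12 e = true)
    (hlo : ((segCutQ 0 : ℚ) : ℝ) ≤ lin7TupleVal e) (hhi : lin7TupleVal e ≤ ((segCutQ 3 : ℚ) : ℝ)) :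
    ((linBinOf e, linPrim e), e) ∈ linSegAll := by
  obtain ⟨i, hi, hc, hax1, hax2⟩ := exists_mem_linVecsFirst_of_linTupleOK hok
  obtain ⟨a0, c, ax⟩ := e
  refine mem_linSegAll_iff.mpr ⟨i, by omega, mem_linSegPart_iff.mpr ⟨c, hc, ?_⟩⟩
  exact mem_linCandsOf_iff.mpr ⟨ax, a0, ⟨hax1, hax2⟩, lin_a0_mem_range hax1 hlo hhi, rfl⟩

/-- Counting over the whole list = sum over the seven parts. [folklore] -/
theorem countP_linSegAll (p : (ℕ × Bool) × (ℤ × List ℤ × ℕ) → Bool) :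
    linSegAll.countP p = (linSegPart 0).countP p + (linSegPart 1).countP p + (linSegPart 2).countP p +
      (linSegPart 3).countP p + (linSegPart 4).countP p + (linSegPart 5).countP p +
      (linSegPart 6).countP p := by
  have e : linSegAll = linSegPart 0 ++ linSegPart 1 ++ linSegPart 2 ++ linSegPart 3 ++ linSegPart 4 ++
      linSegPart 5 ++ linSegPart 6 := by
    simp [linSegAll, List.range_succ]
  rw [e]
  simp only [List.countP_append]

/-- The tuples of the whole list have no duplicates, given the seven part facts (parts are disjoint by
the first non-zero index). [folklore] -/
theorem nodup_linSegAll_snd (h : ∀ i, i < 7 → ((linSegPart i).map Prod.snd).Nodup) :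
    (linSegAll.map Prod.snd).Nodup := by
  unfold linSegAll
  rw [List.map_flatMap, List.nodup_flatMap]
  constructor
  · intro i hi
    exact h i (List.mem_range.mp hi)
  · refine List.Pairwise.imp_of_mem ?_ (List.nodup_range (n := 7))
    intro i j hi hj hij e hei hej
    -- an element of both would have `firstNZ` equal to `i` and to `j`
    simp only [List.mem_map] at hei hej
    obtain ⟨bi, hbi, hbif⟩ := hei
    obtain ⟨bj, hbj, hbjf⟩ := hej
    obtain ⟨ci, hci, hbci⟩ := mem_linSegPart_iff.mp hbi
    obtain ⟨cj, hcj, hbcj⟩ := mem_linSegPart_iff.mp hbj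
    obtain ⟨_, _, -, -, rfl⟩ := mem_linCandsOf_iff.mp hbci
    obtain ⟨_, _, -, -, rfl⟩ := mem_linCandsOf_iff.mp hbcj
    simp only at hbif hbjf
    have e1 := firstNZ_of_mem_linVecsFirst hci
    have e2 := firstNZ_of_mem_linVecsFirst hcj
    have : ci = cj := by
      have h1 := congrArg (fun t : ℤ × List ℤ × ℕ => t.2.1) hbif
      have h2 := congrArg (fun t : ℤ × List ℤ × ℕ => t.2.1) hbjf
      simp only at h1 h2
      rw [h1, h2]
    subst this
    exact hij (e1.symm.trans e2)

end ColumnFaceL11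
end Summit.CriticalPhenomena.Ising3D
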